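import Literature.Probability.Percolation.AnnulusAlternation
import HarnessLib

/-!
# Two open crossings not hooked up through the hexagon are separated by a closed path through it

Topic `Literature/Probability/Percolation`; family `crit-perc` / site percolation on `𝕋`.
The EXISTENCE half of disc duality (Bollobás–Riordan, *Percolation* (2006), Ch. 7, Lemma 5,
p. 169: "either an open crossing … or a closed crossing …") in the form consumed by the
"exactly one hook-up" dictionary of four alternating arms in cluster form: let
`A = {n ≤ |·| ≤ N}` (`triAnn n N`, `1 ≤ n < N`) be a hexagonal annulus inside the hexagon
`Λ_N = triBall N`, and let `B₁ : a ⇝ t_a`, `B₂ : g ⇝ t_g` be open paths of `A` from `∂Λ_n` to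
`∂Λ_N`. **If `a` and `g` are NOT joined by an open path of the whole hexagon `Λ_N` (through the
hole), then there are closed sites `r, r' ∈ ∂Λ_N` joined by a CLOSED path of `Λ_N` but not by a
closed path of `A`** (`exists_closed_path_through_ball`); consequently two closed crossings of `A`
lying in distinct closed clusters of `A` are joined by a closed path of `Λ_N`
(`exists_closed_crossings_joined_through_ball`).

Proof (Kesten's boundary of the occupied cluster, 1982 §2.3, read off the boundary traversal of a
disc as in `AnnulusAlternation.lean`, but in the HEXAGON): let `K` be the open cluster of `a` in
`Λ_N` and `U` the component of `g` in `Λ_N ∖ K` (`annCluster 0 N`, `annComp 0 N`: empty hole).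
`U` is a disc; its boundary darts point outside `Λ_N` or into `K` (closed tails). In the perimeter
coordinate from `t_g`, the sites of `K ∩ ∂Λ_N` span a range `[m, M] ∌ 0` containing no site of `U`
strictly inside (`triBall_not_interleaved_shift`). Along `∂U` from `t_g →` outside, the tail advances
by unit steps below `m` up to the first `K`-dart, whose tail `r` sits at `m - 1`; the following run
of `K`-darts has closed, successively equal or adjacent tails and ends at an outside-dart whose
tail `r'` is the anticlockwise neighbour of a `K`-site, hence at `M + 1`. So `r ⇝ r'` is a closed
path of `Λ_N` with `0 < m - 1 < t_a < M + 1`, and a closed path of `A` from `r` to `r'` would be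
interleaved with `t_g ⇝ g → hole ⇝ a ⇝ t_a`. Everything here is proved; no named facts.

## References

* B. Bollobás, O. Riordan, *Percolation*, CUP (2006), Ch. 7 §7.2.2, Lemma 5 p. 169. [BollobasRiordan2006]
* H. Kesten, *Percolation theory for mathematicians* (1982), §2.2–2.3. [KestenPTM1982]

Tree: `AnnulusAlternation.lean` (`annCluster`, `annComp`, `annCompFin`, dart bookkeeping),
`TriBallDisc.lean` (`hexShift`, `hexPos_of_leftApex_in/out`, `triBall_not_interleaved_shift`),
`TriPolyhexDisc.lean` (`exists_isTriDisc_of_coconnected`), `SitePaths.lean` (`PathIn`).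
-/

noncomputable section

open Finset

namespace Literature.Probability.Percolation

open LatticeModels

variable {N : ℕ} {ω : SiteConfig (Site 2)} {s₁ s₂ : Site 2}

/-! ### The annulus with empty hole is the hexagon -/

/-- `triAnn 0 N = Λ_N`. [folklore] -/
theorem triAnn_zero_eq (N : ℕ) : triAnn 0 N = (↑(triBall N) : Set (Site 2)) := by
  ext v
  rw [mem_triAnn, Finset.mem_coe, mem_triBall_iff]
  have := triNorm_nonneg v
  push_cast
  exact ⟨fun h => h.2, fun h => ⟨this, h⟩⟩

/-- **The complement of the component of `s₂` in `Λ_N ∖ K` is connected**, `K` the open cluster of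
`s₁` in `Λ_N` reaching `∂Λ_N` at `t₁`: the cluster is joined off the component to the outside, every
other site off the component escapes to one of them, and the outside is connected. [folklore] -/
theorem ballComp_coconnected {t₁ : Site 2} (ht₁ : t₁ ∈ annCluster 0 N ω s₁) (ht₁N : triNorm t₁ = N) :
    ∀ o ∉ annCompFin 0 N ω s₁ s₂, ∀ o' ∉ annCompFin 0 N ω s₁ s₂,
      PathIn triGraph ((↑(annCompFin 0 N ω s₁ s₂) : Set (Site 2))ᶜ) o o' := by
  set U := annComp 0 N ω s₁ s₂ with hU
  set Cl := annCluster 0 N ω s₁ with hCl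
  have hcoe : ((↑(annCompFin 0 N ω s₁ s₂) : Set (Site 2))ᶜ) = Uᶜ := by rw [coe_annCompFin]
  rw [hcoe]
  have hUA : ∀ v ∈ U, v ∈ triAnn 0 N := fun v hv => (annComp_subset hv).1
  have outU : ∀ v : Site 2, (N : ℤ) < triNorm v → v ∈ Uᶜ := fun v hv hvU => by
    have := (mem_triAnn.1 (hUA v hvU)).2; omega
  have clU : ∀ v ∈ Cl, v ∈ Uᶜ := fun v hv hvU => (annComp_subset hvU).2 hv
  have clOut : ∀ c ∈ Cl, ∃ w : Site 2, (N : ℤ) < triNorm w ∧ PathIn triGraph Uᶜ c w := by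
    intro c hc
    obtain ⟨w, hadj, hw⟩ := exists_adj_triNorm_eq_add_one t₁
    exact ⟨w, by omega, ((pathIn_annCluster hc ht₁).mono fun v hv => clU v hv).tail hadj (outU w (by omega))⟩
  have toOut : ∀ o ∈ Uᶜ, ∃ w : Site 2, (N : ℤ) < triNorm w ∧ PathIn triGraph Uᶜ o w := by
    intro o ho
    by_cases hoN : (N : ℤ) < triNorm o
    · exact ⟨o, hoN, PathIn.refl ho⟩
    push Not at hoN
    have hoA : o ∈ triAnn 0 N := mem_triAnn.2 ⟨by exact_mod_cast triNorm_nonneg o, hoN⟩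
    by_cases hoCl : o ∈ Cl
    · exact clOut o hoCl
    · obtain ⟨b, hb, hp⟩ := exists_escape hoA ho hoCl
      rcases hb with hbCl | hbN
      · obtain ⟨w, hw, p3⟩ := clOut b hbCl
        exact ⟨w, hw, hp.trans p3⟩
      · exact ⟨b, hbN, hp⟩
  have outConn : ∀ w w' : Site 2, (N : ℤ) < triNorm w → (N : ℤ) < triNorm w' → PathIn triGraph Uᶜ w w' := by
    intro w w' hw hw'
    have h0 := triNorm_nonneg w
    have h0' := triNorm_nonneg w'
    set K : ℕ := (triNorm w + triNorm w').toNat with hK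
    obtain ⟨z, hz, hp⟩ := exists_pathIn_outward w K (by omega)
    obtain ⟨z', hz', hp'⟩ := exists_pathIn_outward w' K (by omega)
    have hs := pathIn_triSphere (K := K) (by omega) hz hz'
    refine ((hp.mono fun v hv => outU v (lt_of_lt_of_le hw hv)).trans
      (hs.mono fun v hv => outU v ?_)).trans (hp'.mono fun v hv => outU v (lt_of_lt_of_le hw' hv)).symm
    have hv' : triNorm v = K := hv
    omega
  intro o ho o' ho'
  rw [mem_annCompFin] at ho ho'
  obtain ⟨w, hw, hp⟩ := toOut o ho
  obtain ⟨w', hw', hp'⟩ := toOut o' ho'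
  exact (hp.trans (outConn w w' hw hw')).trans hp'.symm

/-! ### The closed path through the hexagon -/

/-- **Two open crossings of the annulus not hooked up through the hexagon are separated by a closed
path through the hexagon** (`1 ≤ n < N`): if `B₁ : a ⇝ t_a` and `B₂ : g ⇝ t_g` are open paths of
`A = {n ≤ |·| ≤ N}` from `∂Λ_n` to `∂Λ_N` and `a`, `g` are not joined by an open path of `Λ_N`,
then some closed sites `r, r'` of `∂Λ_N` are joined by a closed path of `Λ_N` and by no closed path
of `A`. (The frontier of the open
cluster of `a` in `Λ_N` facing `g`, read off the boundary cycle of the component of `g` in its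
complement.) [cite: BollobasRiordan2006, Ch. 7 Lemma 5 p. 169] -/
theorem exists_closed_path_through_ball {n : ℕ} (hn : 1 ≤ n) (hnN : n < N) {a g ta tg : Site 2}
    (ha : triNorm a = n) (hta : triNorm ta = N) (hg : triNorm g = n) (htg : triNorm tg = N)
    (hB₁ : PathIn triGraph (triAnn n N ∩ ω) a ta) (hB₂ : PathIn triGraph (triAnn n N ∩ ω) g tg)
    (hsep : ¬ PathIn triGraph ((↑(triBall N) : Set (Site 2)) ∩ ω) a g) :
    ∃ r r' : Site 2, triNorm r = N ∧ triNorm r' = N ∧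
      PathIn triGraph ((↑(triBall N) : Set (Site 2)) \ ω) r r' ∧ ¬ PathIn triGraph (triAnn n N \ ω) r r' := by
  classical
  have hN : 1 ≤ N := by omega
  set ball : Set (Site 2) := (↑(triBall N) : Set (Site 2)) with hball
  have hA0 : triAnn 0 N = ball := triAnn_zero_eq N
  have hAsub : triAnn n N ⊆ triAnn 0 N := fun v hv => by
    rw [mem_triAnn] at hv ⊢; push_cast; have := triNorm_nonneg v; omega
  set K := annCluster 0 N ω a with hKdef
  set U := annComp 0 N ω a g with hUdef
  set G := annCompFin 0 N ω a g with hG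
  have hB₁' : PathIn triGraph (triAnn 0 N ∩ ω) a ta := hB₁.mono (Set.inter_subset_inter_left _ hAsub)
  have hB₂' : PathIn triGraph (triAnn 0 N ∩ ω) g tg := hB₂.mono (Set.inter_subset_inter_left _ hAsub)
  have hsep' : ¬ PathIn triGraph (triAnn 0 N ∩ ω) a g := by rwa [hA0]
  have htgU : tg ∈ U := mem_annComp_of_pathIn hsep' hB₂'
  have hgU : g ∈ U := mem_annComp_of_pathIn hsep' (PathIn.refl hB₂'.left_mem)
  have htaK : ta ∈ K := hB₁'
  have htgω : tg ∈ ω := hB₂.right_mem.2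
  have disj : ∀ v ∈ U, v ∉ K := fun v hv => (annComp_subset hv).2
  have hUball : ∀ v ∈ U, v ∈ ball := fun v hv => hA0 ▸ (annComp_subset hv).1
  have hKball : ∀ v ∈ K, v ∈ ball := fun v hv => hA0 ▸ (annCluster_subset hv).1
  have hKN : ∀ v ∈ K, triNorm v ≤ N := fun v hv => mem_triBall_iff.1 (Finset.mem_coe.1 (hKball v hv))
  -- the disc `U` and its boundary traversal from `tg →` outside
  obtain ⟨b₀, hb₀⟩ := exists_isTriDisc_of_coconnected _ G rfl ⟨g, mem_annCompFin.2 hgU⟩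
    (fun p hp q hq => by rw [coe_annCompFin]; exact pathIn_annComp (mem_annCompFin.1 hp) (mem_annCompFin.1 hq))
    (ballComp_coconnected htaK hta)
  obtain ⟨o, hadjo, ho⟩ := exists_adj_triNorm_eq_add_one tg
  have hoG : o ∉ G := fun h' => by
    have := (mem_triAnn.1 (annComp_subset (mem_annCompFin.1 h')).1).2; omega
  have hdt : (tg, o) ∈ triBdryDarts G := mem_triBdryDarts.2 ⟨mem_annCompFin.2 htgU, hoG, hadjo⟩
  have h := hb₀.rebase hdt
  set P := #(triBdryDarts G) with hP
  set it : ℕ → Site 2 × Site 2 := fun k => triBdryIter G (tg, o) k with hit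
  have it_mem : ∀ k, it k ∈ triBdryDarts G := fun k => triBdryIter_mem hdt k
  have it_succ : ∀ k, it (k + 1) = triBdrySucc G (it k) := fun k => triBdryIter_succ G _ k
  have it_tail : ∀ k, (it k).1 ∈ U := fun k => mem_annCompFin.1 (mem_triBdryDarts.1 (it_mem k)).1
  have it_adj : ∀ k, triGraph.Adj (it k).1 (it k).2 := fun k => (mem_triBdryDarts.1 (it_mem k)).2.2
  -- types of darts by the head
  set Out : ℕ → Prop := fun k => (N : ℤ) < triNorm (it k).2 with hOut
  set ClD : ℕ → Prop := fun k => (it k).2 ∈ K with hClD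
  have cases2 : ∀ k, Out k ∨ ClD k := fun k => by
    rcases head_cases (it_mem k) with h0 | h1 | h1
    · have := triNorm_nonneg (it k).2; push_cast at h0; omega
    · exact Or.inl h1
    · exact Or.inr h1
  have out_not_cl : ∀ k, Out k → ¬ ClD k := fun k h1 h2 => by
    have := hKN _ h2; simp only [hOut] at h1; omega
  have head_kept_or_tail_kept : ∀ k, (it (k + 1)).1 = (it k).1 ∨ (it (k + 1)).2 = (it k).2 := fun k => by
    rw [it_succ]; exact fst_succ_eq_or_snd_succ_eq G (it k)
  have Out0 : Out 0 := by show (N : ℤ) < triNorm (triBdryIter G (tg, o) 0).2; rw [triBdryIter_zero]; show (N : ℤ) < triNorm o; omega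
  have OutP : Out P := by show (N : ℤ) < triNorm (triBdryIter G (tg, o) P).2; rw [h.cycle_len]; show (N : ℤ) < triNorm o; omega
  have tail0 : (it 0).1 = tg := by show (triBdryIter G (tg, o) 0).1 = tg; rw [triBdryIter_zero]
  -- perimeter coordinates from `tg`; the extreme `K`-sites of `∂Λ_N`
  set pos : Site 2 → ℤ := fun v => hexShift N tg v with hpos
  have pos_tg : pos tg = 0 := hexShift_self N tg
  have pos_inj : ∀ {u v : Site 2}, triNorm u = N → triNorm v = N → pos u = pos v → u = v :=
    fun hu hv e => hexShift_injOn hN hu hv e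
  have pos_range : ∀ {v : Site 2}, triNorm v = N → 0 ≤ pos v ∧ pos v < 6 * N := fun hv => hexShift_range hN htg hv
  set S := (triBall N).filter (fun v => triNorm v = N ∧ v ∈ K) with hS
  have memS : ∀ {v : Site 2}, v ∈ S ↔ triNorm v = N ∧ v ∈ K := fun {v} => by
    rw [hS, mem_filter, mem_triBall_iff]
    exact ⟨fun h => h.2, fun h => ⟨h.1.le, h⟩⟩
  have htaS : ta ∈ S := memS.2 ⟨hta, htaK⟩
  obtain ⟨cm, hcmS, hcm⟩ := S.exists_min_image pos ⟨ta, htaS⟩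
  obtain ⟨cM, hcMS, hcM⟩ := S.exists_max_image pos ⟨ta, htaS⟩
  obtain ⟨hcmN, hcmK⟩ := memS.1 hcmS
  obtain ⟨hcMN, hcMK⟩ := memS.1 hcMS
  have hm_ta : pos cm ≤ pos ta := hcm ta htaS
  have hta_M : pos ta ≤ pos cM := hcM ta htaS
  have hm0 : 0 < pos cm := by
    have hne : pos cm ≠ pos tg := fun e => disj tg htgU ((pos_inj hcmN htg e) ▸ hcmK)
    rw [pos_tg] at hne
    exact lt_of_le_of_ne (pos_range hcmN).1 hne.symm
  -- no site of `U` on `∂Λ_N` lies strictly between two `K`-sites: the gap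
  have gap : ∀ u ∈ U, triNorm u = N → pos u < pos cm ∨ pos cM < pos u := by
    intro u hu huN
    by_contra hcon
    push Not at hcon
    obtain ⟨h1, h2⟩ := hcon
    have hne1 : pos u ≠ pos cm := fun e => disj u hu ((pos_inj huN hcmN e) ▸ hcmK)
    have hne2 : pos u ≠ pos cM := fun e => disj u hu ((pos_inj huN hcMN e) ▸ hcMK)
    have hlt1 : pos cm < pos u := lt_of_le_of_ne h1 hne1.symm
    have hlt2 : pos u < pos cM := lt_of_le_of_ne h2 hne2
    exact triBall_not_interleaved_shift hN U htg htg hcmN huN hcMN (by rw [hexShift_self]; exact hm0) hlt1 hlt2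
      (pathIn_ball_inter_annComp htgU hu) (pathIn_ball_diff_annComp hcmK hcMK)
  -- there is a `K`-dart: the first exit of `g ⇝ a` (inside `Λ_N`) from `U`
  have hex_cl : ∃ k, ClD k ∧ k < P := by
    have hga : PathIn triGraph ball g a := pathIn_triBall (by omega) (by omega)
    have haU : a ∉ U := fun h' => disj a h' (PathIn.refl hB₁'.left_mem)
    obtain ⟨u, v, hu, hv, hvball, huv, -⟩ := hga.exit (R := U) hgU haU
    have hvK : v ∈ K := by
      by_contra hvK
      exact hv (mem_annComp_of_adj hu ⟨hA0 ▸ hvball, hvK⟩ huv)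
    have hd : (u, v) ∈ triBdryDarts G :=
      mem_triBdryDarts.2 ⟨mem_annCompFin.2 hu, fun h' => disj v (mem_annCompFin.1 h') hvK, huv⟩
    obtain ⟨k, hkP, hk⟩ := h.cycle _ hd
    exact ⟨k, by show (it k).2 ∈ K; simp only [hit]; rw [hk]; exact hvK, hkP⟩
  set p₁ := Nat.find hex_cl with hp₁
  obtain ⟨ClD_p₁, p₁P⟩ := Nat.find_spec hex_cl
  have out_lt : ∀ k < p₁, Out k := fun k hk =>
    (cases2 k).resolve_right fun hC => Nat.find_min hex_cl hk ⟨hC, lt_trans hk p₁P⟩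
  have p₁_pos : p₁ ≠ 0 := fun e => out_not_cl 0 Out0 (e ▸ ClD_p₁)
  -- the first outside run stays below `m`
  have run0 : ∀ k ≤ p₁, triNorm (it k).1 = N ∧ pos (it k).1 < pos cm := by
    intro k hk
    induction k with
    | zero => rw [tail0, pos_tg]; exact ⟨htg, hm0⟩
    | succ k ih =>
      obtain ⟨ihN, ihpos⟩ := ih (by omega)
      have hOk : Out k := out_lt k (by omega)
      rcases triBdrySucc_eq_or G (it k) with e | e
      · rw [← it_succ] at e
        have : (it (k + 1)).1 = (it k).1 := by rw [e]
        rw [this]; exact ⟨ihN, ihpos⟩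
      · rw [← it_succ] at e
        have htl : (it (k + 1)).1 = triLeftApex (it k).1 (it k).2 := by rw [e]
        have hinU : triLeftApex (it k).1 (it k).2 ∈ U := htl ▸ it_tail (k + 1)
        have hin : triLeftApex (it k).1 (it k).2 ∈ triBall N := Finset.mem_coe.1 (hUball _ hinU)
        obtain ⟨haN, hsucc⟩ := hexPos_of_leftApex_in hN ihN hOk (it_adj k) hin
        rw [htl]
        refine ⟨haN, ?_⟩
        by_cases heq : triLeftApex (it k).1 (it k).2 = tg
        · rw [heq, pos_tg]; exact hm0
        · have e1 : pos (triLeftApex (it k).1 (it k).2) = pos (it k).1 + 1 :=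
            hexShift_eq_add_one hN htg ihN haN hsucc heq
          rcases gap _ hinU haN with hlt | hlt
          · exact hlt
          · exfalso; rw [e1] at hlt; omega
  -- at `p₁` the tail is kept: `r = (it q).1`, closed, at `m - 1`
  obtain ⟨q, hq⟩ : ∃ q, p₁ = q + 1 := Nat.exists_eq_succ_of_ne_zero p₁_pos
  have Out_q : Out q := out_lt q (by omega)
  have trans1 : it (q + 1) = ((it q).1, triLeftApex (it q).1 (it q).2) := by
    rcases triBdrySucc_eq_or G (it q) with e | e
    · rw [it_succ, e]
    · exfalso
      have hh : (it (q + 1)).2 = (it q).2 := by rw [it_succ, e]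
      have : ClD q := by show (it q).2 ∈ K; rw [← hh, ← hq]; exact ClD_p₁
      exact out_not_cl q Out_q this
  have tail_p₁ : (it p₁).1 = (it q).1 := by rw [hq, trans1]
  have head_p₁ : (it p₁).2 = triLeftApex (it q).1 (it q).2 := by rw [hq, trans1]
  obtain ⟨hrN, hrpos⟩ := run0 q (by omega)
  have hk₁K : triLeftApex (it q).1 (it q).2 ∈ K := head_p₁ ▸ ClD_p₁
  obtain ⟨hk₁N, hk₁succ⟩ := hexPos_of_leftApex_in hN hrN Out_q (it_adj q) (Finset.mem_coe.1 (hKball _ hk₁K))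
  have hk₁ne : triLeftApex (it q).1 (it q).2 ≠ tg := fun e => disj tg htgU (e ▸ hk₁K)
  have hposk₁ : pos (triLeftApex (it q).1 (it q).2) = pos (it q).1 + 1 :=
    hexShift_eq_add_one hN htg hrN hk₁N hk₁succ hk₁ne
  have hmk₁ : pos cm ≤ pos (triLeftApex (it q).1 (it q).2) := hcm _ (memS.2 ⟨hk₁N, hk₁K⟩)
  have hr_closed : (it q).1 ∉ ω := tail_p₁ ▸ (tail_of_cluster_dart (it_mem p₁) ClD_p₁).2.1
  have hr_ne : (it q).1 ≠ tg := fun e => hr_closed (e ▸ htgω)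
  have hrpos0 : 0 < pos (it q).1 := by
    have hne : pos (it q).1 ≠ pos tg := fun e => hr_ne (pos_inj hrN htg e)
    rw [pos_tg] at hne
    exact lt_of_le_of_ne (pos_range hrN).1 hne.symm
  have hr_ta : pos (it q).1 < pos ta := by omega
  -- the run of `K`-darts after `p₁`
  have hex_out : ∃ k, p₁ < k ∧ Out k := ⟨P, p₁P, OutP⟩
  set p₂ := Nat.find hex_out with hp₂
  obtain ⟨p₁_lt_p₂, Out_p₂⟩ := Nat.find_spec hex_out
  have cl_run : ∀ k, p₁ ≤ k → k < p₂ → ClD k := fun k hk hk' => by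
    rcases Nat.eq_or_lt_of_le hk with e | hlt
    · rw [← e]; exact ClD_p₁
    · exact (cases2 k).resolve_left fun hO => Nat.find_min hex_out hk' ⟨hlt, hO⟩
  have chain : ∀ k, p₁ ≤ k → k < p₂ → PathIn triGraph (ball \ ω) (it q).1 (it k).1 := by
    intro k hk hk'
    induction k, hk using Nat.le_induction with
    | base =>
      rw [tail_p₁]
      exact PathIn.refl ⟨hUball _ (it_tail q), hr_closed⟩
    | succ k hk ih =>
      have ih' := ih (by omega)
      have hmem : (it (k + 1)).1 ∈ ball \ ω :=
        ⟨hUball _ (it_tail (k + 1)), (tail_of_cluster_dart (it_mem (k + 1)) (cl_run _ (by omega) hk')).2.1⟩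
      rcases fst_triBdrySucc_eq_or_adj G (it_adj k) with e | hadj
      · rw [← it_succ] at e; rw [e] at hmem ⊢; exact ih'
      · rw [← it_succ] at hadj; exact ih'.tail hadj hmem
  -- at `p₂` the tail is kept: `r'`, closed, at `M + 1`
  have hp₂1 : p₂ - 1 + 1 = p₂ := by omega
  have ClD_p₂1 : ClD (p₂ - 1) := cl_run (p₂ - 1) (by omega) (by omega)
  have trans2 : it p₂ = ((it (p₂ - 1)).1, triLeftApex (it (p₂ - 1)).1 (it (p₂ - 1)).2) := by
    have hsucc : it p₂ = triBdrySucc G (it (p₂ - 1)) := by rw [← it_succ, hp₂1]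
    rcases triBdrySucc_eq_or G (it (p₂ - 1)) with e | e
    · rw [hsucc, e]
    · exfalso
      have hh : (it p₂).2 = (it (p₂ - 1)).2 := by rw [hsucc, e]
      have : Out (p₂ - 1) := by show (N : ℤ) < triNorm (it (p₂ - 1)).2; rw [← hh]; exact Out_p₂
      exact out_not_cl _ this ClD_p₂1
  obtain ⟨r', hr'⟩ : ∃ r', r' = (it (p₂ - 1)).1 := ⟨_, rfl⟩
  obtain ⟨k', hk'⟩ : ∃ k', k' = (it (p₂ - 1)).2 := ⟨_, rfl⟩
  have hr'U : r' ∈ U := hr' ▸ it_tail (p₂ - 1)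
  have hr'closed : r' ∉ ω := hr' ▸ (tail_of_cluster_dart (it_mem (p₂ - 1)) ClD_p₂1).2.1
  have hr'N : triNorm r' = N := by
    have : (it p₂).1 = r' := by rw [trans2, hr']
    rw [← this]; exact norm_of_out_dart (it_mem p₂) Out_p₂
  have hk'K : k' ∈ K := hk' ▸ ClD_p₂1
  have hadj' : triGraph.Adj r' k' := by rw [hr', hk']; exact it_adj (p₂ - 1)
  have hout' : triLeftApex r' k' ∉ triBall N := by
    rw [mem_triBall_iff, not_le]
    have : (it p₂).2 = triLeftApex r' k' := by rw [trans2, hr', hk']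
    rw [← this]; exact Out_p₂
  have hk'N : triNorm k' = N := by
    have h1 := hKN k' hk'K
    have h2 := triNorm_le_triNorm_add_one_of_adj' (triGraph_adj_triLeftApex_right hadj')
    have h3 : (N : ℤ) < triNorm (triLeftApex r' k') := by rw [mem_triBall_iff, not_le] at hout'; exact hout'
    omega
  have hr'ne : r' ≠ tg := fun e => hr'closed (e ▸ htgω)
  have hcw : hexPos N r' = hexPos N k' + 1 ∨ (hexPos N r' = 0 ∧ hexPos N k' = 6 * N - 1) :=
    (hexPos_of_leftApex_out hN hr'N hk'N hadj' hout').imp (fun e => e.symm) id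
  have hposr' : pos r' = pos k' + 1 := hexShift_eq_add_one hN htg hk'N hr'N hcw hr'ne
  have hk'm : pos cm ≤ pos k' := hcm _ (memS.2 ⟨hk'N, hk'K⟩)
  have hta_r' : pos ta < pos r' := by
    rcases gap r' hr'U hr'N with hlt | hlt
    · exfalso; omega
    · omega
  have hE : PathIn triGraph (ball \ ω) (it q).1 r' := hr' ▸ chain (p₂ - 1) (by omega) (by omega)
  refine ⟨(it q).1, r', hrN, hr'N, hE, fun hπ => ?_⟩
  -- a closed path of the annulus from `r` to `r'` is interleaved with `tg ⇝ g → hole ⇝ a ⇝ ta`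
  set X : Set (Site 2) := (triAnn n N \ ω)ᶜ with hX
  have openX : ∀ {u v : Site 2}, PathIn triGraph (triAnn n N ∩ ω) u v → PathIn triGraph (ball ∩ X) u v := fun hp =>
    hp.mono fun z hz => ⟨Finset.mem_coe.2 (mem_triBall_iff.2 (mem_triAnn.1 hz.1).2), fun h' => h'.2 hz.2⟩
  have holeX : ∀ z : Site 2, triNorm z < n → z ∈ ball ∩ X := fun z hz =>
    ⟨Finset.mem_coe.2 (mem_triBall_iff.2 (by omega)), fun h' => by have := (mem_triAnn.1 h'.1).1; omega⟩
  obtain ⟨g₁, hadj₁, hg₁⟩ := exists_adj_mem_triBall_sub_one hn ha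
  obtain ⟨g₂, hadj₂, hg₂⟩ := exists_adj_mem_triBall_sub_one hn hg
  have hg₁' : triNorm g₁ < n := by have := hg₁; push_cast [Nat.cast_sub hn] at this; omega
  have hg₂' : triNorm g₂ < n := by have := hg₂; push_cast [Nat.cast_sub hn] at this; omega
  have phole : PathIn triGraph (ball ∩ X) g₂ g₁ :=
    (pathIn_triBall hg₂ hg₁).mono fun z hz => holeX z (by
      have := mem_triBall_iff.1 (Finset.mem_coe.1 hz); push_cast [Nat.cast_sub hn] at this; omega)
  have hQ : PathIn triGraph (ball ∩ X) tg ta :=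
    ((((openX hB₂).symm.tail hadj₂ (holeX g₂ hg₂')).trans phole).trans
      (PathIn.of_adj (holeX g₁ hg₁') (openX hB₁).left_mem hadj₁.symm)).trans (openX hB₁)
  have hP' : PathIn triGraph (ball ∩ Xᶜ) (it q).1 r' := by
    rw [hX, compl_compl]
    exact hπ.mono fun z hz => ⟨Finset.mem_coe.2 (mem_triBall_iff.2 (mem_triAnn.1 hz.1).2), hz⟩
  exact triBall_not_interleaved_shift hN X htg htg hrN hta hr'N (by rw [hexShift_self]; exact hrpos0) hr_ta hta_r' hQ hP'

/-- **Consequently the two closed crossing clusters are hooked up through the hexagon**: under the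
hypotheses of `exists_closed_path_through_ball` there are closed crossings `w₁ ⇝ r`, `w₂ ⇝ r'` of
`A` (from `∂Λ_n` to `∂Λ_N`, closed paths of `A`) which are not joined by a closed path of `A` but
ARE joined by a closed path of `Λ_N` (the closed path `r ⇝ r'` of `Λ_N` must leave `A` into the
hole, and does so from sites of norm `n`). [cite: BollobasRiordan2006, Ch. 7 Lemma 5 p. 169] -/
theorem exists_closed_crossings_joined_through_ball {n : ℕ} (hn : 1 ≤ n) (hnN : n < N) {a g ta tg : Site 2}
    (ha : triNorm a = n) (hta : triNorm ta = N) (hg : triNorm g = n) (htg : triNorm tg = N)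
    (hB₁ : PathIn triGraph (triAnn n N ∩ ω) a ta) (hB₂ : PathIn triGraph (triAnn n N ∩ ω) g tg)
    (hsep : ¬ PathIn triGraph ((↑(triBall N) : Set (Site 2)) ∩ ω) a g) :
    ∃ w₁ w₂ r r' : Site 2, triNorm w₁ = n ∧ triNorm w₂ = n ∧ triNorm r = N ∧ triNorm r' = N ∧
      PathIn triGraph (triAnn n N \ ω) w₁ r ∧ PathIn triGraph (triAnn n N \ ω) w₂ r' ∧
      ¬ PathIn triGraph (triAnn n N \ ω) w₁ w₂ ∧ PathIn triGraph ((↑(triBall N) : Set (Site 2)) \ ω) w₁ w₂ := by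
  obtain ⟨r, r', hrN, hr'N, hE, hnot⟩ := exists_closed_path_through_ball hn hnN ha hta hg htg hB₁ hB₂ hsep
  set ball : Set (Site 2) := (↑(triBall N) : Set (Site 2)) with hball
  -- descending from a rim site along a closed path of `Λ_N` that leaves the annulus: the exit site is a crossing foot
  have descend : ∀ {x y : Site 2}, triNorm x = N → PathIn triGraph (ball \ ω) x y →
      ¬ PathIn triGraph (triAnn n N \ ω) x y →
      ∃ w : Site 2, triNorm w = n ∧ PathIn triGraph (triAnn n N \ ω) w x ∧ PathIn triGraph (ball \ ω) x w := by
    intro x y hxN hxy hno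
    rcases hxy.exit_or (R := triAnn n N) (mem_triAnn.2 ⟨by omega, by omega⟩) with h | ⟨z, w, hz, hw, hwS, hzw, hxz⟩
    · exact absurd (h.mono (A' := triAnn n N \ ω) fun v hv => ⟨hv.1, hv.2.2⟩) hno
    · have hwN : triNorm w ≤ N := mem_triBall_iff.1 (Finset.mem_coe.1 hwS.1)
      have hwn : triNorm w < n := by
        by_contra h'; exact hw (mem_triAnn.2 ⟨not_lt.1 h', hwN⟩)
      have hzn : triNorm z = n := by
        have h1 := (mem_triAnn.1 hz).1
        have h2 := triNorm_le_triNorm_add_one_of_adj' hzw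
        omega
      exact ⟨z, hzn, (hxz.mono (A' := triAnn n N \ ω) fun v hv => ⟨hv.1, hv.2.2⟩).symm, hxz.mono (A' := ball \ ω) fun v hv => hv.2⟩
  obtain ⟨w₁, hw₁n, hw₁r, hrw₁⟩ := descend hrN hE hnot
  obtain ⟨w₂, hw₂n, hw₂r', hr'w₂⟩ := descend hr'N hE.symm fun h' => hnot h'.symm
  refine ⟨w₁, w₂, r, r', hw₁n, hw₂n, hrN, hr'N, hw₁r, hw₂r', fun h' => hnot ((hw₁r.symm.trans h').trans hw₂r'), ?_⟩
  exact (hrw₁.symm.trans hE).trans hr'w₂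

end Literature.Probability.Percolation
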